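import Mathlib

/-!
# No first digit on the `(1,2,3,3,3,3)` frame — LEMMA A(b) of «S2-21» (pub-hsemireg, S4-PUSH corner 2)

Third part of the kernel leg of seat s4-search-2 gen 13 (cell `pub-hsemireg`) for §5 of
`s4push/search-2/g11/LIFT2-search-2-g11.md`; companions: `TwoSlotFrameTable.lean` (the 2-vector table of a slot
pair and the induced atom table) and `DegreeSixSecondDigit.lean` (the `(2,2,3,3,3,3)` edge unit: LEMMAS A(a), B,
D(a)).  This file treats the other frame with a non-degenerate leading digit on the slot pair `0, 1`: dual type
`c′ = (1,2,3,3,3,3)` (`v₂(σ₂) = 1`; 63 twisted M2 census classes), where LEMMA A(b) says that NONE of the 28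
non-degenerate leading digits `C̄` admits a first digit — «the (2,2)-part of `C̄∧X̄ = ε′h̄₀h̄₁ + h̄₀ ⊗ S̄₁` would
force `C̄ = h̄₀`, impossible for a non-degenerate `C̄` (rank 4 ≠ 2)» (machine of record: 0∕28 on 63∕63 units,
`lift2` = g10's `degree4_digit2`).

**Setting** (CRITERION L digit tower, `p = 2`, `m = 2`, `q = 4`; notation of `DegreeSixSecondDigit`): commutative
torsion-free `Λ^{ev} = ⊕Λ^{2k}ℤ¹²`, `hᵢ = x_{2i}x_{2i+1}`, `S_k = e_k(h₂, …, h₅)`, `G = h₃h₄h₅` (`S₁G = S₄`,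
`TwoSlotFrameTable.slotSum_G`); here `D = 2h₀ + 4h₁ + 8S₁`, `T₂(B) = σ₂D^[2] − 4σ₁DB + 16σ₀B^[2]`, and the data
have `σ₁ = 0`, `σ₀ = 2s + 1`, `σ₂ = 4t + 2`.  A leading digit is `C = β₀₁h₀ + β₂₃h₁ + N` with `N` its cross-line
part (`h₀N = h₁N = 0`, `N·N = 2N₂`, `N₂ = νh₀h₁`), non-degenerate: Pfaffian `β₀₁β₂₃ + ν = 2p + 1`; `X` is ANY first
digit and `Y` ANY remainder (arbitrary ring elements with divided squares `X₂`, `Y₂`; `E` = the divided square of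
`C + 2X + 4Y`, pinned by `DegreeSixSecondDigit.sq_leading`).

* `sq_Dmixed`: `D·D = 2D₂` for the closed form `D₂ = 8h₀h₁ + 16h₀S₁ + 32h₁S₁ + 64S₂` (`= D^[2]`).
* `T2_leading_mixed`: `T₂(C + 2X + 4Y) = 2⁵·((t+s+p+1)h₀h₁ + h₀S₁ + CX) + 2⁶·(explicit)` — so the `k = 2`
  congruence `T₂ ≡ 0 mod 2⁶` is the digit equation `(t+s+p+1)h₀h₁ + h₀S₁ + CX ∈ 2Λ^{ev}`.
* `obstruction_mixed`: if `f = f₀₁h₀ + f₂₃h₁ + F` (`F` a cross line or `0`, `F·N = ϖh₀h₁` by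
  `TwoSlotFrameTable.crossLine_pairᵢ`) has `f₂₃` ODD and EVEN pairing `f₀₁β₂₃ + f₂₃β₀₁ + ϖ`, then any solution
  `X` of the digit equation (any `ε′`-coefficient `e`, any witness `W`) forces `h₀h₁S₄ = x₀⋯x₁₁ ∈ 2Λ^{ev}` —
  impossible (the functional is `f·h₃h₄h₅`, the memo's (2,2)-component argument).  Such `f` exists for EVERY
  non-degenerate `C̄`: `β₀₁` even ⟹ `f = h₁`; `β₀₁, β₂₃` odd ⟹ `f = h₀ + h₁`; `β₀₁` odd, `β₂₃` even ⟹ `ν` odd (odd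
  Pfaffian), so some `nᵢ` is odd and `f = h₁ + F`, `F` the complementary cross line (`ϖ = ∓nᵢ`).  Hence all 28
  leading digits of these 63 classes die at the degree-4 second digit — kernel, given the registered `T₂` and
  the atom table.

Proofs: `linear_combination` with explicit cofactors (generator `s4push/search-2/g13/cert/gen4.py`, stdlib only).
Scope ∕ honest framing: as in the companions — elementary commutative algebra, theorems only (count-neutral);
pencil steps of a CLASS-LEVEL necessary-condition sieve at the special fibre `E⁶`; not LEMMA C ((2,2,2,3,3,3)
frame, decomposable leading digits — needs odd elements), not D(b)∕E, not the tower bookkeeping; no object, no `σ`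
computation, no Hodge statement; nothing here bears on HC ∕ HC_CM ∕ HC_AV.
-/

namespace Summit.Ventures.HSemireg.MixedFrameLeadingDigit

variable {R : Type*} [CommRing R]

/-! ### 1. LEMMA A(b): the digit equation and its obstruction on the mixed frame -/

/-- Pinning on the `(1,2,3,3,3,3)` frame: `D = 2h₀ + 4h₁ + 8S₁`, `D₂ := 8h₀h₁ + 16h₀S₁ + 32h₁S₁ + 64S₂` (closed
form of the elementary symmetric square of `2h₀, 4h₁, 8h₂, …, 8h₅`) satisfies `D·D = 2D₂` (`D₂ = D^[2]`). -/
theorem sq_Dmixed (h₀ h₁ S₁ S₂ D D₂ : R) (hD : D = 2 * h₀ + 4 * h₁ + 8 * S₁) (hD₂ : D₂ = 8 * (h₀ *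
    h₁) + 16 * (h₀ * S₁) + 32 * (h₁ * S₁) + 64 * S₂) (qh₀ : h₀ * h₀ = 0) (qh₁ : h₁ * h₁ = 0) (qS₁₁ :
    S₁ * S₁ = 2 * S₂) :
    D * D = 2 * D₂ := by
  linear_combination ((4) * h₁ + (2) * h₀ + (8) * S₁ + D) * hD + ((-2)) * hD₂ + (4) * qh₀ + (16) *
    qh₁ + (64) * qS₁₁

/-- **LEMMA A(b), setting: the degree-4 digit equation on the `(1,2,3,3,3,3)` frame** (63 M2 classes; `v₂(σ₂) =
1`).  `C = β₀₁h₀ + β₂₃h₁ + N` non-degenerate (Pfaffian `β₀₁β₂₃ + ν = 2p + 1`), `σ₁ = 0`, `σ₀ = 2s + 1`, `σ₂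
= 4t + 2`; `X` ANY first digit, `Y` ANY remainder (`E` the divided square of `C + 2X + 4Y`, pinned by
`sq_leading`).  Then `T₂(C + 2X + 4Y) = 2⁵·((t+s+p+1)h₀h₁ + h₀S₁ + CX) + 2⁶·(explicit)`: in `Λ^{ev}ℤ¹²` the
`k = 2` congruence holds iff `(t+s+p+1)h₀h₁ + h₀S₁ + CX ∈ 2Λ^{ev}` — the memo's `C̄∧X̄ = ε′h̄₀h̄₁ + h̄₀ ⊗
S̄₁`. -/
theorem T2_leading_mixed (h₀ h₁ σ₀ σ₁ σ₂ s t p nu β₀₁ β₂₃ S₁ S₂ N N₂ D D₂ C C₂ X X₂ Y Y₂ E T₂ : R)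
    (hT₂ : T₂ = σ₂ * D₂ - 4 * σ₁ * (D * (C + 2 * X + 4 * Y)) + 16 * σ₀ * E) (hE : E = C₂ + 2 * (C *
    X) + 4 * (C * Y) + 4 * X₂ + 8 * (X * Y) + 16 * Y₂) (hD : D = 2 * h₀ + 4 * h₁ + 8 * S₁) (hD₂ : D₂
    = 8 * (h₀ * h₁) + 16 * (h₀ * S₁) + 32 * (h₁ * S₁) + 64 * S₂) (hC : C = β₀₁ * h₀ + β₂₃ * h₁ + N)
    (hC₂ : C₂ = β₀₁ * β₂₃ * (h₀ * h₁) + (β₀₁ * h₀ + β₂₃ * h₁) * N + N₂) (qh₀ : h₀ * h₀ = 0) (qh₁ :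
    h₁ * h₁ = 0) (zh₀N : h₀ * N = 0) (zh₁N : h₁ * N = 0) (hN₂ : N₂ = nu * (h₀ * h₁)) (hPf : nu = 2 *
    p + 1 - β₀₁ * β₂₃) (hσ₁ : σ₁ = 0) (hσ₂ : σ₂ = 4 * t + 2) (hσ₀ : σ₀ = 2 * s + 1) :
    T₂ = 32 * ((t + s + p + 1) * (h₀ * h₁) + h₀ * S₁ + C * X) + 64 * (s * p * (h₀ * h₁) + t * (h₀ *
      S₁) + (1 + 2 * t) * (h₁ * S₁) + s * (C * X) + σ₂ * S₂ + σ₀ * (C * Y + X₂ + 2 * (X * Y) + 4 *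
      Y₂)) := by
  linear_combination (1) * hT₂ + ((16) * σ₀) * hE + ((-8) * X * σ₁ + (-16) * Y * σ₁ + (-4) * C * σ₁)
    * hD + (σ₂) * hD₂ + ((-16) * h₁ * σ₁ + (-8) * h₀ * σ₁ + (-32) * X + (-64) * X * s + (32) * X *
    σ₀ + (-32) * S₁ * σ₁) * hC + ((16) * σ₀) * hC₂ + ((-8) * σ₁ * β₀₁) * qh₀ + ((-16) * σ₁ * β₂₃) *
    qh₁ + ((-8) * σ₁ + (16) * σ₀ * β₀₁) * zh₀N + ((-16) * σ₁ + (16) * σ₀ * β₂₃) * zh₁N + ((16) * σ₀)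
    * hN₂ + ((16) * h₀ * h₁ * σ₀) * hPf + ((-8) * h₀ * h₁ * β₂₃ + (-16) * h₀ * h₁ * β₀₁ + (-32) * X
    * h₁ + (-16) * X * h₀ + (-64) * Y * h₁ + (-32) * Y * h₀ + (-32) * S₁ * h₁ * β₂₃ + (-32) * S₁ *
    h₀ * β₀₁ + (-32) * S₁ * N + (-64) * S₁ * X + (-128) * S₁ * Y) * hσ₁ + ((8) * h₀ * h₁ + (32) * S₁
    * h₁ + (16) * S₁ * h₀) * hσ₂ + ((16) * h₀ * h₁ + (32) * h₀ * h₁ * p + (32) * X * h₁ * β₂₃ + (32)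
    * X * h₀ * β₀₁ + (32) * X * N) * hσ₀

/-- **LEMMA A(b): on the `(1,2,3,3,3,3)` frame NO leading digit admits a first digit.**  Let `C = β₀₁h₀ + β₂₃h₁
+ N` and `f = f₀₁h₀ + f₂₃h₁ + F` with `F` a cross line or `0` (`h₀F = h₁F = 0`, `F·N = ϖ·h₀h₁`), `f₂₃ = 2r +
1` ODD and pairing `f₀₁β₂₃ + f₂₃β₀₁ + ϖ = 2m` EVEN; `G = h₃h₄h₅`.  If `X` solves the digit equation `e·h₀h₁
+ h₀S₁ + CX = 2W` (`e, X, W` ARBITRARY), then `h₀h₁S₄ = x₀⋯x₁₁ = 2·(explicit)` — impossible in `Λ^{ev}ℤ¹²`.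
Such `f` exists for EVERY non-degenerate `C̄`: `β₀₁` even ⟹ `f = h₁`; `β₀₁, β₂₃` odd ⟹ `f = h₀ + h₁`; `β₀₁`
odd, `β₂₃` even ⟹ the Pfaffian being odd forces `ν` odd, so some `nᵢ` is odd and `f = h₁ + F` with `F` the
complementary cross line (`ϖ = ∓nᵢ`, `crossLine_pairᵢ`).  Hence all 28 leading digits die at the degree-4
second digit (memo: «(2,2)-part would force B̄₀ = h̄₀ — impossible», machine 0∕28 on 63∕63 units). -/
theorem obstruction_mixed (h₀ h₁ m r e f₀₁ f₂₃ ϖ β₀₁ β₂₃ S₁ S₄ G N F f C X W : R) (hC : C = β₀₁ * h₀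
    + β₂₃ * h₁ + N) (hf : f = f₀₁ * h₀ + f₂₃ * h₁ + F) (qh₀ : h₀ * h₀ = 0) (qh₁ : h₁ * h₁ = 0) (zh₀N
    : h₀ * N = 0) (zh₁N : h₁ * N = 0) (zh₀F : h₀ * F = 0) (zh₁F : h₁ * F = 0) (hFN : F * N = ϖ * (h₀
    * h₁)) (hS₁G : S₁ * G = S₄) (hX : e * (h₀ * h₁) + h₀ * S₁ + C * X = 2 * W) (hm : f₀₁ * β₂₃ + f₂₃
    * β₀₁ + ϖ = 2 * m) (hr : f₂₃ = 2 * r + 1) :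
    h₀ * h₁ * S₄ = 2 * (f * (G * W) - m * (h₀ * h₁ * (X * G)) - r * (h₀ * h₁ * S₄)) := by
  linear_combination ((-1) * f * X * G) * hC + ((-1) * G * h₀ * h₁ * e + (-1) * X * G * h₁ * β₂₃ +
    (-1) * X * G * h₀ * β₀₁ + (-1) * X * G * N + (-1) * S₁ * G * h₀) * hf + ((-1) * G * h₁ * f₀₁ * e
    + (-1) * X * G * β₀₁ * f₀₁ + (-1) * S₁ * G * f₀₁) * qh₀ + ((-1) * G * h₀ * f₂₃ * e + (-1) * X *
    G * β₂₃ * f₂₃) * qh₁ + ((-1) * X * G * f₀₁) * zh₀N + ((-1) * X * G * f₂₃) * zh₁N + ((-1) * G *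
    h₁ * e + (-1) * X * G * β₀₁ + (-1) * S₁ * G) * zh₀F + ((-1) * X * G * β₂₃) * zh₁F + ((-1) * X *
    G) * hFN + ((-1) * h₀ * h₁ * f₂₃) * hS₁G + (f * G) * hX + ((-1) * X * G * h₀ * h₁) * hm + ((-1)
    * S₄ * h₀ * h₁) * hr

end Summit.Ventures.HSemireg.MixedFrameLeadingDigit
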